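import Mathlib.Data.ZMod.Basic
import Mathlib.GroupTheory.NoncommCoprod
import Summits.MatrixMultiplication.OmegaCensus.BoxKeyLift
import Summits.MatrixMultiplication.OmegaCensus.BoxBadKleinRotation

/-!
# ω-census, family (b3): conjecture C9 — the key-lift lemma in MODEL COORDINATES, and cyclic coordinate homomorphisms

HONEST FRAMING (pub-omega census; verbatim): lottery ticket; floor = certified bounds/negative ranges.
Census BOOKKEEPING (conjecture C9 of the cell, STRUCTURE.md §2; pub-omega kernel-l4 gen 16, task K-5): the second half of the
key-lift machine of `BoxKeyLift`.  When the small subgroup `N` is the image of an INJECTIVE homomorphism `ψ : M →* G` from a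
CONCRETE finite group `M` (in the census always a product of cyclic groups), the key pattern and the gauge words can be written in
`M`-coordinates and the independence of the pattern in the key graph becomes a `decide` in `M`:

* `not_boxUseful_of_model`: given `ψ`, injective box coordinates `yv : ιY → G`, `wv : ιW → G` (`|ιY| = |ιW| = 3`), a table
  `γ` with `gaugeWord (yv i) (wv j) (yv i') (wv j') = ψ (γ i j i' j')` (the only `G`-side obligations: `81` word normal forms) and
  a concrete pattern `T₀ ⊆ M × ιY × ιW` with `t.1 ≠ γ(t.cols, t'.cols) · t'.1` for distinct `t, t'` (decidable) and
  `9·|M| ≤ 5·#T₀`, the group `G` is not box-useful.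
* `cycHom n a ha : Multiplicative (ZMod n) →* G`, `ofAdd k ↦ a ^ k.val` (for `a ^ n = 1`), with `cycHom_ofAdd`, its value on
  the generator, injectivity from `orderOf a = n`, and the extension lemmas `mzmod_ext` / `prod_ext` (homomorphisms out of
  `Multiplicative (ZMod n)` / out of a product are determined on generators / on the two axes) used to turn two conjugation
  relations on generators into the rewriting rules `x · ψ m · t = ψ (σ m) · x · t` (`conj_rule`, `conj_rule_inv`).
Nothing here is progress on `ω`.
-/

namespace Summit.MatrixMultiplication.OmegaCensus

open Finset ProductBoxBound

namespace KeyLift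

variable {G : Type*} [Group G] {M : Type*} [Group M]

/-- Base cells interact iff `n = g(c,c') · n'`. [folklore] -/
theorem cellWord_baseCell_eq_one_iff (t t' : G × G × G) :
    cellWord (baseCell t) (baseCell t') = 1 ↔ t.1 = gaugeWord t.2.1 t.2.2 t'.2.1 t'.2.2 * t'.1 := by
  have h1 : cellWord (baseCell t) (baseCell t') = cellWord (liftCell t 1) (liftCell t' 1) :=
    (cellWord_liftCell_same t t' 1).symm
  rw [h1, cellWord_liftCell_eq_one_iff]
  constructor
  · intro h
    have : t.1⁻¹ * gaugeWord t.2.1 t.2.2 t'.2.1 t'.2.2 * t'.1 = 1 := by rw [← h]; group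
    calc t.1 = t.1 * (t.1⁻¹ * gaugeWord t.2.1 t.2.2 t'.2.1 t'.2.2 * t'.1) := by rw [this, mul_one]
      _ = gaugeWord t.2.1 t.2.2 t'.2.1 t'.2.2 * t'.1 := by group
  · intro h
    calc (1 : G) * 1⁻¹ = 1 := by group
      _ = t.1⁻¹ * t.1 := (inv_mul_cancel t.1).symm
      _ = t.1⁻¹ * (gaugeWord t.2.1 t.2.2 t'.2.1 t'.2.2 * t'.1) := by rw [← h]
      _ = t.1⁻¹ * gaugeWord t.2.1 t.2.2 t'.2.1 t'.2.2 * t'.1 := by rw [mul_assoc]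

/-- **Key lift in model coordinates.** `ψ : M →* G` injective; injective box coordinates `yv, wv` from `3`-element index
types; a gauge table `γ` with `gaugeWord (yv i) (wv j) (yv i') (wv j') = ψ (γ i j i' j')`; a pattern `T₀ ⊆ M × ιY × ιW`
independent in the model key graph (`t.1 ≠ γ · t'.1` for `t ≠ t'`) with `9|M| ≤ 5 #T₀`.  Then `G` is not box-useful. [folklore] -/
theorem not_boxUseful_of_model [Fintype G] [DecidableEq G] [Fintype M] [DecidableEq M]
    {ιY ιW : Type*} [Fintype ιY] [Fintype ιW] [DecidableEq ιY] [DecidableEq ιW]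
    (ψ : M →* G) (hψ : Function.Injective ψ)
    (yv : ιY → G) (wv : ιW → G) (hy : Function.Injective yv) (hw : Function.Injective wv)
    (hY3 : Fintype.card ιY = 3) (hW3 : Fintype.card ιW = 3)
    (γ : ιY → ιW → ιY → ιW → M)
    (hγ : ∀ i j i' j', gaugeWord (yv i) (wv j) (yv i') (wv j') = ψ (γ i j i' j'))
    (T₀ : Finset (M × ιY × ιW))
    (hkey : ∀ t ∈ T₀, ∀ t' ∈ T₀, t ≠ t' → t.1 ≠ γ t.2.1 t.2.2 t'.2.1 t'.2.2 * t'.1)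
    (hbig : 9 * Fintype.card M ≤ 5 * #T₀) : ¬ BoxUseful G := by
  classical
  set N : Subgroup G := ψ.range with hN
  have cardN : Nat.card N = Fintype.card M := by
    rw [hN, ← Nat.card_eq_fintype_card]
    exact (Nat.card_congr (MonoidHom.ofInjective hψ).toEquiv).symm
  set Y : Finset G := Finset.univ.image yv with hY
  set W : Finset G := Finset.univ.image wv with hW
  have cY : #Y = 3 := by rw [hY, Finset.card_image_of_injective _ hy, Finset.card_univ, hY3]
  have cW : #W = 3 := by rw [hW, Finset.card_image_of_injective _ hw, Finset.card_univ, hW3]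
  let Φ : M × ιY × ιW → G × G × G := fun t => (ψ t.1, yv t.2.1, wv t.2.2)
  have Φ_inj : Function.Injective Φ := by
    rintro ⟨m, i, j⟩ ⟨m', i', j'⟩ h
    simp only [Φ, Prod.mk.injEq] at h
    obtain ⟨h1, h2, h3⟩ := h
    rw [hψ h1, hy h2, hw h3]
  set T : Finset (G × G × G) := T₀.image Φ with hT
  have cT : #T = #T₀ := by rw [hT, Finset.card_image_of_injective _ Φ_inj]
  refine KeyLift.not_boxUseful N cY cW (T := T) ?_ ?_ ?_ ?_ (by rw [cT, cardN]; exact hbig)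
  · intro t ht
    obtain ⟨⟨m, i, j⟩, -, rfl⟩ := Finset.mem_image.1 ht
    simp only [Φ, Finset.mem_product, Finset.mem_univ, true_and, hY, hW]
    exact ⟨Finset.mem_image_of_mem _ (Finset.mem_univ _), Finset.mem_image_of_mem _ (Finset.mem_univ _)⟩
  · intro t ht
    obtain ⟨⟨m, i, j⟩, -, rfl⟩ := Finset.mem_image.1 ht
    exact ⟨m, rfl⟩
  · intro t ht t' ht'
    obtain ⟨⟨m, i, j⟩, -, rfl⟩ := Finset.mem_image.1 ht
    obtain ⟨⟨m', i', j'⟩, -, rfl⟩ := Finset.mem_image.1 ht'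
    change gaugeWord (yv i) (wv j) (yv i') (wv j') ∈ N
    rw [hγ]
    exact ⟨_, rfl⟩
  · intro t ht t' ht' hne hw1
    obtain ⟨⟨m, i, j⟩, hm, rfl⟩ := Finset.mem_image.1 ht
    obtain ⟨⟨m', i', j'⟩, hm', rfl⟩ := Finset.mem_image.1 ht'
    rw [cellWord_baseCell_eq_one_iff] at hw1
    change ψ m = gaugeWord (yv i) (wv j) (yv i') (wv j') * ψ m' at hw1
    rw [hγ, ← map_mul] at hw1
    have hmm : m = γ i j i' j' * m' := hψ hw1
    have hne0 : (m, i, j) ≠ (m', i', j') := fun e => hne (by rw [e])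
    exact hkey _ hm _ hm' hne0 hmm

/-! ### Rewriting rules from conjugation data -/

/-- From `x ψ(m) x⁻¹ = ψ(σ m)` for all `m`: the right-associated rule `x · (ψ m · t) = ψ (σ m) · (x · t)`. [folklore] -/
theorem conj_rule {ψ : M →* G} {x : G} {σ : M → M} (h : ∀ m, x * ψ m * x⁻¹ = ψ (σ m)) (m : M) (t : G) :
    x * (ψ m * t) = ψ (σ m) * (x * t) := by
  rw [← h m]; group

/-- Terminal form of `conj_rule`. [folklore] -/
theorem conj_rule' {ψ : M →* G} {x : G} {σ : M → M} (h : ∀ m, x * ψ m * x⁻¹ = ψ (σ m)) (m : M) :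
    x * ψ m = ψ (σ m) * x := by
  rw [← h m]; group

/-- The rule for `x⁻¹`, via a right inverse `τ` of `σ`: `x⁻¹ · (ψ m · t) = ψ (τ m) · (x⁻¹ · t)`. [folklore] -/
theorem conj_rule_inv {ψ : M →* G} {x : G} {σ τ : M → M} (h : ∀ m, x * ψ m * x⁻¹ = ψ (σ m))
    (hτ : ∀ m, σ (τ m) = m) (m : M) (t : G) : x⁻¹ * (ψ m * t) = ψ (τ m) * (x⁻¹ * t) := by
  have e : ψ m = x * ψ (τ m) * x⁻¹ := by rw [h, hτ]
  rw [e]; group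

/-- Terminal form of `conj_rule_inv`. [folklore] -/
theorem conj_rule_inv' {ψ : M →* G} {x : G} {σ τ : M → M} (h : ∀ m, x * ψ m * x⁻¹ = ψ (σ m))
    (hτ : ∀ m, σ (τ m) = m) (m : M) : x⁻¹ * ψ m = ψ (τ m) * x⁻¹ := by
  have e : ψ m = x * ψ (τ m) * x⁻¹ := by rw [h, hτ]
  rw [e]; group

/-- `ψ m · (ψ m' · t) = ψ (m m') · t`. [folklore] -/
theorem psi_mul_left (ψ : M →* G) (m m' : M) (t : G) : ψ m * (ψ m' * t) = ψ (m * m') * t := by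
  rw [map_mul, mul_assoc]

/-- `ψ m · ψ m' = ψ (m m')`. [folklore] -/
theorem psi_mul (ψ : M →* G) (m m' : M) : ψ m * ψ m' = ψ (m * m') := (map_mul ψ m m').symm

/-- `(ψ m)⁻¹ = ψ m⁻¹`. [folklore] -/
theorem psi_inv (ψ : M →* G) (m : M) : (ψ m)⁻¹ = ψ m⁻¹ := (map_inv ψ m).symm

/-- Conjugation data as equality of homomorphisms: if `(conj x) ∘ ψ = ψ ∘ σ` as homomorphisms then pointwise. [folklore] -/
theorem conj_of_hom_eq {ψ : M →* G} {x : G} {σ : M →* M}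
    (h : (MulAut.conj x).toMonoidHom.comp ψ = ψ.comp σ) (m : M) : x * ψ m * x⁻¹ = ψ (σ m) := by
  have := congrArg (fun f : M →* G => f m) h
  simpa [MulAut.conj_apply] using this

/-! ### Cyclic coordinate homomorphisms -/

/-- `a ^ (k % n) = a ^ k` when `a ^ n = 1`. [folklore] -/
theorem pow_mod_eq_of_pow_eq_one {a : G} {n : ℕ} (ha : a ^ n = 1) (k : ℕ) : a ^ (k % n) = a ^ k := by
  conv_rhs => rw [← Nat.mod_add_div k n, pow_add, pow_mul, ha, one_pow, mul_one]

/-- The coordinate homomorphism `Multiplicative (ZMod n) →* G`, `ofAdd k ↦ a ^ k.val`, for `a ^ n = 1`. [folklore] -/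
def cycHom (n : ℕ) [NeZero n] (a : G) (ha : a ^ n = 1) : Multiplicative (ZMod n) →* G where
  toFun k := a ^ (Multiplicative.toAdd k).val
  map_one' := by simp
  map_mul' x y := by
    change a ^ (Multiplicative.toAdd x + Multiplicative.toAdd y).val = a ^ (Multiplicative.toAdd x).val * a ^ (Multiplicative.toAdd y).val
    rw [← pow_add, ZMod.val_add, pow_mod_eq_of_pow_eq_one ha]

/-- Value of `cycHom`. [folklore] -/
theorem cycHom_apply (n : ℕ) [NeZero n] (a : G) (ha : a ^ n = 1) (k : Multiplicative (ZMod n)) :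
    cycHom n a ha k = a ^ (Multiplicative.toAdd k).val := rfl

/-- `cycHom` on `ofAdd k`. [folklore] -/
theorem cycHom_ofAdd (n : ℕ) [NeZero n] (a : G) (ha : a ^ n = 1) (k : ZMod n) :
    cycHom n a ha (Multiplicative.ofAdd k) = a ^ k.val := rfl

/-- `cycHom` on the generator (`n > 1`). [folklore] -/
theorem cycHom_ofAdd_one (n : ℕ) [NeZero n] [Fact (1 < n)] (a : G) (ha : a ^ n = 1) :
    cycHom n a ha (Multiplicative.ofAdd 1) = a := by
  rw [cycHom_ofAdd, ZMod.val_one, pow_one]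

/-- `cycHom` is injective when `a` has order exactly `n`. [folklore] -/
theorem cycHom_injective (n : ℕ) [NeZero n] (a : G) (ha : a ^ n = 1) (hord : orderOf a = n) :
    Function.Injective (cycHom n a ha) := by
  rw [injective_iff_map_eq_one]
  intro k hk
  rw [cycHom_apply] at hk
  have hdvd : n ∣ (Multiplicative.toAdd k).val := by
    have := orderOf_dvd_of_pow_eq_one hk
    rwa [hord] at this
  have hlt : (Multiplicative.toAdd k).val < n := ZMod.val_lt _
  have h0 : (Multiplicative.toAdd k).val = 0 := Nat.eq_zero_of_dvd_of_lt hdvd hlt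
  have : Multiplicative.toAdd k = 0 := (ZMod.val_eq_zero _).1 h0
  exact toAdd_eq_zero.mp this

/-- Homomorphisms out of `Multiplicative (ZMod n)` are determined by the image of `ofAdd 1`. [folklore] -/
theorem mzmod_ext {n : ℕ} [NeZero n] {f g : Multiplicative (ZMod n) →* G}
    (h : f (Multiplicative.ofAdd 1) = g (Multiplicative.ofAdd 1)) : f = g := by
  refine MonoidHom.ext fun k => ?_
  have hk : k = (Multiplicative.ofAdd (1 : ZMod n)) ^ (ZMod.val (Multiplicative.toAdd k)) := by
    rw [← ofAdd_nsmul, nsmul_eq_mul, mul_one, ZMod.natCast_zmod_val]; rfl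
  rw [hk, map_pow, map_pow, h]

/-- Homomorphisms out of a product of groups are determined by their restrictions to the two axes. [folklore] -/
theorem prod_ext {A B : Type*} [Group A] [Group B] {f g : A × B →* G}
    (h₁ : ∀ a, f (a, 1) = g (a, 1)) (h₂ : ∀ b, f (1, b) = g (1, b)) : f = g := by
  ext ⟨a, b⟩
  have e : ((a, b) : A × B) = (a, 1) * (1, b) := by simp
  rw [e, map_mul, map_mul, h₁, h₂]

end KeyLift

end Summit.MatrixMultiplication.OmegaCensus
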